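import Mathlib
import HarnessLib
import Literature.Analysis.FluidPDE.TypeIAncientMild
import Literature.Analysis.FluidPDE.KNSSRemark61
import Literature.Analysis.FluidPDE.CurlFreeLiouville
import Literature.Analysis.FluidPDE.NSLocalLerayBackwardUniqueness
import Literature.Analysis.FluidPDE.BarkerPrange2020VorticityAlignmentTypeIHolds
import Literature.Analysis.UnboundedOperators.HeatKernelBoundedData
import Summits.NavierStokesRegularity.NavierStokesRegularity.Theorems.PoloidalWindowDoorPoloidalWindowRigidityWindow
import Summits.NavierStokesRegularity.NavierStokesRegularity.Theorems.PoloidalWindowDoorPoloidalWindowRigidityHotLoopsSlabNullRigidity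

/-!
# Route `PoloidalWindowDoor`, crux `PoloidalWindowRigidity` (K2, stmt-NavierStokesRegularity-19708) — STUB HP4′
# `stub_nullRigidity` of line `hot_loops` v3 (ns-idea-8 g6): IRROTATIONAL PATCHES ON ALL PLANES NEAR `{y₂ = z₁}` AT ALL
# TIMES NEAR ANY `s₀ < 0` ARE IMPOSSIBLE (null rigidity)

Cell ns-regularity-ideate, seat ns-poloidal-K2-p2 g11 (stub-worker on K2; `--supports` the crux item).

* `stub_nullRigidity` — VERBATIM: planes (landed `…HotLoopsSlabNullRigidity.curl_eq_zero_on_plane_of_disc`) ⇒ slab ⇒ `curl v(s) ≡ 0` (tree `curl_eq_zero_of_eqOn_open`) ⇒ `v(s,·)` constant (tree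
  `eq_of_curl_eq_zero_of_isDivFree_of_bounded`) for `|s − s₀| < δ'` ⇒ constant in time there (tree `oseenDuhamel_eq_zero_of_const`,
  `heatExtension_const`) ⇒ by TIME-ANALYTICITY (tree `analyticOnNhd_uncurry`) `v ≡ c` on `(−∞,0) × ℝ³` ⇒ the pin `√2·|N| ≤ |N|` at
  `t = −2` is absurd.

WHAT THIS IS NOT: not a claim about Navier–Stokes regularity — a rigidity lemma for HYPOTHETICAL class profiles, all ingredients
tree theorems (bears_on LADDER-NS N0, rung N0-LocalTubeDoorPoloidal).
-/

noncomputable section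

-- the summit and its single sub-problem share the name (CONVENTIONS §1), as in every Theorems file
set_option linter.dupNamespace false

namespace Summit.NavierStokesRegularity.NavierStokesRegularity.Theorems.PoloidalWindowDoorPoloidalWindowRigidityHotLoopsNullRigidity

open MeasureTheory Set Function Filter Topology Metric
open scoped RealInnerProductSpace InnerProductSpace
open Literature.Analysis Literature.Analysis.FluidPDE Literature.Analysis.UnboundedOperators
open Summit.NavierStokesRegularity.NavierStokesRegularity.Theorems.PoloidalWindowDoorPoloidalWindowRigidityWindow
open Summit.NavierStokesRegularity.NavierStokesRegularity.Theorems.LocalSineTubeDoorProfileAlignedWindowRigidityAncient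
open Summit.NavierStokesRegularity.NavierStokesRegularity.Theorems.PoloidalWindowDoorPoloidalWindowRigidityHotLoopsSlabNullRigidity

/-- **STUB HP4′ `stub_nullRigidity` (VERBATIM, line `hot_loops` v3 of crux `PoloidalWindowRigidity`).** -/
theorem stub_nullRigidity :
    ∀ (C : ℝ) (v : ℝ → EuclideanSpace ℝ (Fin 3) → EuclideanSpace ℝ (Fin 3)),
      Literature.Analysis.FluidPDE.HasTypeITimeDecay C v →
      ContinuousOn (Function.uncurry v) (Set.Iio (0 : ℝ) ×ˢ Set.univ) →
      (∀ s t : ℝ, s < t → t < 0 → ∀ x, v t x =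
        Literature.Analysis.UnboundedOperators.heatExtension (v s) (t - s) x -
          Literature.Analysis.FluidPDE.oseenDuhamel 1 s v v t x) →
      (∀ t < 0, Literature.Analysis.FluidPDE.VectorCalculus.IsDivFree (v t)) →
      (∀ s < 0, ∀ y, ⟪Literature.Analysis.FluidPDE.curl (v s) y, EuclideanSpace.single 2 1⟫_ℝ = 0) →
      v (-1) 0 2 ≠ 0 → (∀ t < 0, ∀ x, Real.sqrt (-t) * |v t x 2| ≤ |v (-1) 0 2|) →
      (∃ s₀ z₁ δ : ℝ, s₀ < 0 ∧ 0 < δ ∧ ∀ s z₀ : ℝ, |s - s₀| < δ → |z₀ - z₁| < δ →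
          (∃ (y₀ : EuclideanSpace ℝ (Fin 3)) (r : ℝ), y₀ 2 = z₀ ∧ 0 < r ∧
          ∀ y : EuclideanSpace ℝ (Fin 3), y 2 = z₀ → dist y y₀ < r → Literature.Analysis.FluidPDE.curl (v s) y = 0)) →
      False := by
  intro C v hrate hcont hmild hdiv _hpol hN hsup hnull
  obtain ⟨s₀, z₁, δ, hs₀, hδ, hnull⟩ := hnull
  have hA : IsTypeIAncientMild C v := isTypeIAncientMild_of_class hrate hcont hmild hdiv
  -- a time window around `s₀` inside `(-∞, 0)` on which every slice is irrotational, hence constant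
  set δ' : ℝ := min δ (-s₀ / 2) with hδ'
  have hδ'0 : 0 < δ' := lt_min hδ (by linarith)
  have hδ'δ : δ' ≤ δ := min_le_left _ _
  have hδ's : δ' ≤ -s₀ / 2 := min_le_right _ _
  obtain ⟨B, hB⟩ := bdd_of_hasTypeITimeDecay hrate (-s₀ / 4) (by linarith)
  have hconst : ∀ s : ℝ, |s - s₀| < δ' → ∀ x y : EuclideanSpace ℝ (Fin 3), v s x = v s y := by
    intro s hs x y
    have hs' := abs_lt.1 hs
    have hs0 : s < 0 := by linarith
    have han : AnalyticOnNhd ℝ (v s) univ := hA.analyticOnNhd_slice_univ hs0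
    have hplane : ∀ z₀ : ℝ, |z₀ - z₁| < δ → ∀ w : EuclideanSpace ℝ (Fin 3), w 2 = z₀ → curl (v s) w = 0 := by
      intro z₀ hz₀ w hw
      obtain ⟨y₀, r, hy₀, hr, hdisc⟩ := hnull s z₀ (lt_of_lt_of_le hs hδ'δ) hz₀
      exact curl_eq_zero_on_plane_of_disc han hy₀ hr hdisc w hw
    have hslab : ∀ w ∈ {w : EuclideanSpace ℝ (Fin 3) | |w 2 - z₁| < δ}, curl (v s) w = 0 :=
      fun w hw => hplane (w 2) hw w rfl
    have hopen : IsOpen {w : EuclideanSpace ℝ (Fin 3) | |w 2 - z₁| < δ} :=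
      isOpen_lt (continuous_abs.comp ((EuclideanSpace.proj (2 : Fin 3)).continuous.sub continuous_const)) continuous_const
    have hne : ({w : EuclideanSpace ℝ (Fin 3) | |w 2 - z₁| < δ}).Nonempty :=
      ⟨z₁ • EuclideanSpace.single 2 1, by simpa using hδ⟩
    have hcurl : ∀ w, curl (v s) w = 0 := curl_eq_zero_of_eqOn_open han hopen hne hslab
    have hV2 : ContDiff ℝ 2 (v s) := contDiff_infty.1 (hA.contDiff_slice hs0) 2
    exact eq_of_curl_eq_zero_of_isDivFree_of_bounded hV2 hcurl (hdiv s hs0) (fun z => hB s (by linarith) z) x y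
  -- constant in time on the window: the mild identity from `s₁ = s₀ - δ'/2`
  set s₁ : ℝ := s₀ - δ' / 2 with hs₁
  have hs₁w : |s₁ + 0 - s₀| < δ' := by
    rw [hs₁, show s₀ - δ' / 2 + 0 - s₀ = -(δ' / 2) by ring, abs_neg, abs_of_pos (by positivity)]; linarith
  have hwin : ∀ t : ℝ, s₁ < t → t < s₀ + δ' / 2 → ∀ x : EuclideanSpace ℝ (Fin 3), v t x = v s₁ 0 := by
    intro t ht1 ht2 x
    have ht0 : t < 0 := by linarith
    have hmid : ∀ τ ∈ Ioo s₁ t, ∀ y : EuclideanSpace ℝ (Fin 3), v τ y = v τ 0 := by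
      intro τ hτ y
      refine hconst τ ?_ y 0
      rw [abs_lt]; constructor <;> linarith [hτ.1, hτ.2]
    have hD : oseenDuhamel 1 s₁ v v t x = 0 :=
      oseenDuhamel_eq_zero_of_const (b := fun τ => v τ 0) (c := fun τ => v τ 0) hmid hmid x
    have h := hmild s₁ t ht1 ht0 x
    have hfun : v s₁ = fun _ => v s₁ 0 := funext fun y => hconst s₁ (by simpa using hs₁w) y 0
    rw [hD, sub_zero, hfun, heatExtension_const _ (by linarith)] at h
    exact h
  -- TIME-ANALYTICITY: `v ≡ v s₁ 0` on the whole slab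
  have hall : ∀ s < (0 : ℝ), ∀ x : EuclideanSpace ℝ (Fin 3), v s x = v s₁ 0 := by
    intro s hs x
    have hjoint := analyticOnNhd_uncurry hcont (bdd_of_hasTypeITimeDecay hrate) hmild
    have hsl : AnalyticOnNhd ℝ (fun τ : ℝ => v τ x - v s₁ 0) (Iio 0) := by
      intro τ hτ
      have hι : AnalyticAt ℝ (fun τ : ℝ => ((τ, x) : ℝ × EuclideanSpace ℝ (Fin 3))) τ := analyticAt_id.prod analyticAt_const
      have hz : AnalyticAt ℝ (uncurry v) (τ, x) := hjoint (τ, x) ⟨hτ, mem_univ _⟩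
      exact (AnalyticAt.comp (f := fun τ : ℝ => ((τ, x) : ℝ × EuclideanSpace ℝ (Fin 3))) hz hι).sub analyticAt_const
    have hev : (fun τ : ℝ => v τ x - v s₁ 0) =ᶠ[𝓝 s₀] 0 := by
      have hI : Ioo s₁ (s₀ + δ' / 2) ∈ 𝓝 s₀ := Ioo_mem_nhds (by rw [hs₁]; linarith) (by linarith)
      filter_upwards [hI] with τ hτ
      simp only [Pi.zero_apply]
      rw [hwin τ hτ.1 hτ.2 x, sub_self]
    have h := hsl.eqOn_zero_of_preconnected_of_eventuallyEq_zero isPreconnected_Iio hs₀ hev hs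
    simpa [sub_eq_zero] using h
  -- the pin at `t = -2`
  have h2 : v (-2) 0 2 = v (-1) 0 2 := by rw [hall (-2) (by norm_num) 0, hall (-1) (by norm_num) 0]
  have h := hsup (-2) (by norm_num) 0
  rw [h2] at h
  have hNpos : 0 < |v (-1) 0 2| := abs_pos.2 hN
  have hsqrt : 1 < Real.sqrt (-(-2 : ℝ)) := by
    rw [show (1 : ℝ) = Real.sqrt 1 by simp]
    exact Real.sqrt_lt_sqrt (by norm_num) (by norm_num)
  nlinarith

end Summit.NavierStokesRegularity.NavierStokesRegularity.Theorems.PoloidalWindowDoorPoloidalWindowRigidityHotLoopsNullRigidity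

end
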